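import Summits.ABC.IUTFork.Joshi.ATS4RowsCEFReading3GenuineThirtyL
import Summits.ABC.IUTFork.Joshi.ATS4RamificationDivisorsGenuineTower
import HarnessLib

/-!
# [J-IV] (arXiv:2403.10430v2) §6.6–§6.7 / §6.11: rows Y-21c / Y-21e / Y-21f at the GENUINE tower `PrimeTowerDatum.ofNumberFields`
# with top field `L′` — no reading hypothesis on `V^dst_ℚ`, no clause of Lemma 6.7.1, modulo (P2) only

Proof-only composition (0 defs) of the abc-iut cell, R-J «Joshi Y-discharge census» rows **Y-21c / Y-21e / Y-21f** (rung
LADDER-ABC:A2.RESCUE.J), seat abc-iut-E-t24 (gen 10). The two riders of E-t24 gen 9's `ATS4RowsCEFReading3Genuine` (p465152)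
landed three seconds apart: abc-iut-E-t31's `ATS4RamificationDivisorsGenuineTower` (DEFINITION lane: the genuine tower
`PrimeTowerDatum.ofNumberFields L_mod L_tpd M L L′ S e* ℓ`, whose `V^dst_ℚ` IS «some place of `L′` over `p` is ramified over `ℚ`» —
`PrimeTowerDatum.mem_vdstQ_ofNumberFields_iff`, i.e. p465152's hypothesis `hT` as a theorem) and this seat's
`ATS4RowsCEFReading3GenuineThirtyL` (p489308: p465152's clause `h30` «the primes of `2·3·5·ℓ` divide `disc L′`» PROVED from the rows'
binder `hKℓ`). This file is their composition BY NAME (nothing restated): at the genuine tower with top field `L′ = K` — `λ ∈ U_X`,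
`F` a theta field of [IUTchIV] Cor. 2.2, `K/F` Galois with `hK` («`K ⊆ F(E_F[ℓ])`») and `hKℓ` («`K ⊇ F(E_F[ℓ])`»), or simply
`ψ.fieldRange = (thetaCurve P F).divisionField ℓ`, `ℓ ≥ 7` prime, the located rider (P2) `Cor22.CondP2` —

* `PrimeTowerDatum.TowerGlue.vdst_eq_reading3_ofNumberFields_of_condP2` / `…_of_fieldRange_eq_divisionField`: p460339's reading-(3)
  equation `dd.Vdst = primeFactors(30ℓ) ∪ p(Supp 𝔮_{F_tpd}) ∪ primeFactors(disc F_tpd)` HOLDS for every carrier `dd` under E-t31's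
  `TowerGlue` to the genuine tower — [J-IV] Lemma 6.7.1 (1) ⟺ (3) at `L′` (§6.6 p.60 l.56–62, Lemma 6.7.1 p.61 l.20–30);
* `LocusVolumeDatum.rows_cef_ofNumberFields_of_condP2` / `…_of_fieldRange_eq_divisionField`: rows (6.11.1), «component sums»,
  (6.8.11) — `dd.Eq6111 ∧ dd.ComponentSums ∧ dd.Eq6811` — for every carrier `MainBoundGlue`d to the genuine datum, `DescentGlue`d, and
  `TowerGlue`d to the genuine tower, with the genuine component readings (per-`p` hull bundle, arch `0`, different / `q` fibre sums).

What remains a hypothesis, BY NAME: the three glues, the genuine component readings, (P2) (Joshi's Lemma 5.8.7 (2) for his own `ℓ`;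
read off `ITDConditions` by E-t35's provenance theorems), `0 < log q`, `d_mod ≤ [L_mod : ℚ]`. FRAMING (binding): a composition of
PROVED cell theorems; NO side is taken on [IUTchIII] Cor. 3.12 / [IUTchIV] Thm. 1.10, on Joshi's claims or on Mochizuki's report on
them; NOT a test verdict; NOT an abc claim. Typed ≠ proved ≠ endorsed. Theorems only; standard axioms; no `sorry`, instance,
notation, `def` or new `Prop`. FACT rows: none. [claim: Joshi2024ATS4, status: disputed].
-/

noncomputable section

open Finset NumberField IsDedekindDomain
open Literature.IUT.LogVolume Literature.IUT.LogVolume.Cor22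
open Literature.NumberTheory.DiophantineGeometry Literature.NumberTheory.DiophantineGeometry.GenEll
open Literature.NumberTheory.EllipticCurves

namespace Summit.ABC.IUTFork.Joshi.ATS4

section GenuineTower

variable {P : NFPoint} {F : Type} [Field F] [NumberField F] [Algebra P.F F]
  (Lmod Ltpd M L K : Type) [Field Lmod] [NumberField Lmod] [Field Ltpd] [NumberField Ltpd]
  [Field M] [NumberField M] [Field L] [NumberField L] [Field K] [NumberField K]
  [Algebra Lmod Ltpd] [Algebra Ltpd M] [Algebra M K] [Algebra Ltpd L] [Algebra L K] [Algebra Ltpd K]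
  [IsScalarTower Ltpd M K] [IsScalarTower Ltpd L K]
  [Algebra F K] [Algebra P.F K] [IsScalarTower P.F F K]
  (S : Finset (HeightOneSpectrum (𝓞 Lmod))) (estar : ℕ) (ψ : K →ₐ[F] AlgebraicClosure F) {ℓ : ℕ}

/-- **Lemma 6.7.1 (1) ⟺ (3) at the GENUINE tower with top field `L′ = K`: p460339's reading-(3) equation HOLDS** for every carrier
`dd` under E-t31's `TowerGlue` to `PrimeTowerDatum.ofNumberFields L_mod L_tpd M L K S e* ℓ` — `λ ∈ U`, `F` a theta field, `K/F` Galois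
with `hK`, `hKℓ`, `ℓ ≥ 7` prime, (P2). NO `hT` (E-t31 `mem_vdstQ_ofNumberFields_iff`), NO `h30` (p489308). PROVED.
[claim: Joshi2024ATS4, status: disputed] -/
theorem PrimeTowerDatum.TowerGlue.vdst_eq_reading3_ofNumberFields_of_condP2 (hU : P.InU) (hF : IsThetaField P F) [IsGalois F K]
    (hℓ : ℓ.Prime) (h7 : 7 ≤ ℓ) (hP2 : CondP2 P ℓ)
    (hK : letI := thetaCurve_isElliptic hU F
      ((thetaCurve P F).galoisRepTorsion (ℓ : ℤ)).ker ≤ ψ.fieldRange.fixingSubgroup)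
    (hKℓ : ∀ (σ : Field.absoluteGaloisGroup K) (Q : WeierstrassCurve.geomTorsion (thetaCurve P K) (ℓ : ℤ)), σ • Q = Q)
    {dd : LocusVolumeDatum} (GT : PrimeTowerDatum.TowerGlue (PrimeTowerDatum.ofNumberFields Lmod Ltpd M L K S estar ℓ) dd) :
    dd.Vdst = (2 * 3 * 5 * ℓ).primeFactors ∪ (TateDivisorDatum.ofNFPoint P {2, ℓ}).V.image (residueChar P.F) ∪
        (discr P.F).natAbs.primeFactors :=
  GT.vdst_eq_reading3_of_genuine_of_condP2 ψ hU hF hℓ h7 hP2 hK hKℓ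
    (PrimeTowerDatum.mem_vdstQ_ofNumberFields_iff Lmod Ltpd M L K S estar ℓ)

/-- **The same at Joshi's ACTUAL `L′`** (`ψ.fieldRange = (thetaCurve P F).divisionField ℓ`; `K/F` Galois, `hK`, `hKℓ` read off the one
equation by E-t35 g8 §1): `dd.Vdst = primeFactors(30ℓ) ∪ p(Supp 𝔮_{F_tpd}) ∪ primeFactors(disc F_tpd)` for every carrier `TowerGlue`d to
the genuine tower with top field `L′`, modulo (P2) only. PROVED. [claim: Joshi2024ATS4, status: disputed] -/
theorem PrimeTowerDatum.TowerGlue.vdst_eq_reading3_ofNumberFields_of_fieldRange_eq_divisionField (hU : P.InU)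
    (hF : IsThetaField P F) (hℓ : ℓ.Prime) (h7 : 7 ≤ ℓ) (hP2 : CondP2 P ℓ)
    (hψ : ψ.fieldRange = (thetaCurve P F).divisionField ℓ)
    {dd : LocusVolumeDatum} (GT : PrimeTowerDatum.TowerGlue (PrimeTowerDatum.ofNumberFields Lmod Ltpd M L K S estar ℓ) dd) :
    dd.Vdst = (2 * 3 * 5 * ℓ).primeFactors ∪ (TateDivisorDatum.ofNFPoint P {2, ℓ}).V.image (residueChar P.F) ∪
        (discr P.F).natAbs.primeFactors :=
  GT.vdst_eq_reading3_of_fieldRange_eq_divisionField ψ hU hF hℓ h7 hP2 hψ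
    (PrimeTowerDatum.mem_vdstQ_ofNumberFields_iff Lmod Ltpd M L K S estar ℓ)

/-- **ROWS c, e, f AT THE GENUINE TOWER — no reading hypothesis on `V^dst_ℚ`, no clause of Lemma 6.7.1, modulo (P2).** For
`λ ∈ U_X`, `F` a theta field, `K/F` Galois with `hK`/`hKℓ` (`K = L′`), `ℓ ≥ 7` prime with (P2); a carrier `dd` `MainBoundGlue`d to the
genuine datum `MainBoundDatum.ofGenuine L_mod …` (E-t30), `DescentGlue`d (E-t4/E-t59), and `TowerGlue`d (E-t31) to the genuine tower
`PrimeTowerDatum.ofNumberFields L_mod L_tpd M L K S e* ℓ`; the genuine component readings of p456387 (per-`p` hull bundle `ι`, arch `0`,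
different and `q` fibre sums). Then `dd.Eq6111 ∧ dd.ComponentSums ∧ dd.Eq6811`. p489308's `rows_cef_thetaTower_genuine_of_condP2'` with
`hT` supplied by E-t31's `mem_vdstQ_ofNumberFields_iff`. PROVED AS AN IMPLICATION from the glues and readings.
[claim: Joshi2024ATS4, status: disputed] -/
theorem LocusVolumeDatum.rows_cef_ofNumberFields_of_condP2 (hP : P ∈ UP) (hF : IsThetaField P F) [IsGalois F K]
    (hℓ : ℓ.Prime) (h7 : 7 ≤ ℓ) (hP2 : CondP2 P ℓ)
    (hK : letI := thetaCurve_isElliptic hP.1 F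
      ((thetaCurve P F).galoisRepTorsion (ℓ : ℤ)).ker ≤ ψ.fieldRange.fixingSubgroup)
    (hKℓ : ∀ (σ : Field.absoluteGaloisGroup K) (Q : WeierstrassCurve.geomTorsion (thetaCurve P K) (ℓ : ℤ)), σ • Q = Q)
    (h5 : 5 ≤ ℓ) (hq : 0 < (TateDivisorDatum.ofNFPointOver P {2, ℓ} F).logq)
    {dd : LocusVolumeDatum}
    (G : MainBoundGlue (MainBoundDatum.ofGenuine Lmod hℓ h5 (TateDivisorDatum.ofNFPoint P {2, ℓ})
      (TateDivisorDatum.ofNFPointOver P {2, ℓ} F) (TateDivisorDatum.ofNFPointOver P {2, ℓ} K) hq) dd)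
    (hmod : Cor22.dmod P ≤ dMod Lmod)
    {lstar : ℕ} {W : Type} [Fintype W] {D : SecondMainBoundDatum lstar W} (GD : DescentGlue D dd)
    (GT : PrimeTowerDatum.TowerGlue (PrimeTowerDatum.ofNumberFields Lmod Ltpd M L K S estar ℓ) dd)
    (ι : W → HeightOneSpectrum (𝓞 F)) (hι : ∀ w, ι w ∈ (TateDivisorDatum.ofNFPointOver P {2, ℓ} F).V)
    (hAt : ∀ p ∈ dd.Vdst, dd.logVolAt p = ∑ w ∈ Finset.univ with residueChar F (ι w) = p, |Real.log (D.std.loc w).hullVol|)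
    (hArch : dd.logVolArch = 0)
    (DK : Finset (HeightOneSpectrum (𝓞 K))) (hDK : ∀ u, differentDivisor K (Sum.inr u) ≠ 0 → u ∈ DK)
    (hDiffAt : ∀ p ∈ dd.Vdst, dd.logDiffLpAt p =
      (Module.finrank ℚ K : ℝ)⁻¹ * ∑ u ∈ DK with residueChar K u = p, differentDivisor K (Sum.inr u) * logNorm K u)
    (hqAt : ∀ p ∈ dd.Vdst, dd.logqAt p =
      (Module.finrank ℚ F : ℝ)⁻¹ * ∑ w ∈ (TateDivisorDatum.ofNFPointOver P {2, ℓ} F).V with residueChar F w = p,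
        (TateDivisorDatum.ofNFPointOver P {2, ℓ} F).tateDivisor (Sum.inr w) * logNorm F w) :
    dd.Eq6111 ∧ dd.ComponentSums ∧ dd.Eq6811 :=
  LocusVolumeDatum.rows_cef_thetaTower_genuine_of_condP2' ψ hP hF hℓ h7 hP2 hK hKℓ Lmod h5 hq G hmod GD GT
    (PrimeTowerDatum.mem_vdstQ_ofNumberFields_iff Lmod Ltpd M L K S estar ℓ) ι hι hAt hArch DK hDK hDiffAt hqAt

/-- **ROWS c, e, f at the genuine tower over Joshi's ACTUAL `L′`** (`ψ.fieldRange = (thetaCurve P F).divisionField ℓ`; `K/F` Galois,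
`hK`, `hKℓ` supplied by E-t35 g8 §1): `dd.Eq6111 ∧ dd.ComponentSums ∧ dd.Eq6811` from the three glues and the genuine component
readings, modulo (P2) only. PROVED AS AN IMPLICATION. [claim: Joshi2024ATS4, status: disputed] -/
theorem LocusVolumeDatum.rows_cef_ofNumberFields_of_fieldRange_eq_divisionField (hP : P ∈ UP) (hF : IsThetaField P F)
    (hℓ : ℓ.Prime) (h7 : 7 ≤ ℓ) (hP2 : CondP2 P ℓ) (hψ : ψ.fieldRange = (thetaCurve P F).divisionField ℓ)
    (h5 : 5 ≤ ℓ) (hq : 0 < (TateDivisorDatum.ofNFPointOver P {2, ℓ} F).logq)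
    {dd : LocusVolumeDatum}
    (G : MainBoundGlue (MainBoundDatum.ofGenuine Lmod hℓ h5 (TateDivisorDatum.ofNFPoint P {2, ℓ})
      (TateDivisorDatum.ofNFPointOver P {2, ℓ} F) (TateDivisorDatum.ofNFPointOver P {2, ℓ} K) hq) dd)
    (hmod : Cor22.dmod P ≤ dMod Lmod)
    {lstar : ℕ} {W : Type} [Fintype W] {D : SecondMainBoundDatum lstar W} (GD : DescentGlue D dd)
    (GT : PrimeTowerDatum.TowerGlue (PrimeTowerDatum.ofNumberFields Lmod Ltpd M L K S estar ℓ) dd)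
    (ι : W → HeightOneSpectrum (𝓞 F)) (hι : ∀ w, ι w ∈ (TateDivisorDatum.ofNFPointOver P {2, ℓ} F).V)
    (hAt : ∀ p ∈ dd.Vdst, dd.logVolAt p = ∑ w ∈ Finset.univ with residueChar F (ι w) = p, |Real.log (D.std.loc w).hullVol|)
    (hArch : dd.logVolArch = 0)
    (DK : Finset (HeightOneSpectrum (𝓞 K))) (hDK : ∀ u, differentDivisor K (Sum.inr u) ≠ 0 → u ∈ DK)
    (hDiffAt : ∀ p ∈ dd.Vdst, dd.logDiffLpAt p =
      (Module.finrank ℚ K : ℝ)⁻¹ * ∑ u ∈ DK with residueChar K u = p, differentDivisor K (Sum.inr u) * logNorm K u)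
    (hqAt : ∀ p ∈ dd.Vdst, dd.logqAt p =
      (Module.finrank ℚ F : ℝ)⁻¹ * ∑ w ∈ (TateDivisorDatum.ofNFPointOver P {2, ℓ} F).V with residueChar F w = p,
        (TateDivisorDatum.ofNFPointOver P {2, ℓ} F).tateDivisor (Sum.inr w) * logNorm F w) :
    dd.Eq6111 ∧ dd.ComponentSums ∧ dd.Eq6811 :=
  LocusVolumeDatum.rows_cef_thetaTower_divisionField_of_condP2 ψ hP hF hℓ h7 hP2 hψ Lmod h5 hq G hmod GD GT
    (PrimeTowerDatum.mem_vdstQ_ofNumberFields_iff Lmod Ltpd M L K S estar ℓ) ι hι hAt hArch DK hDK hDiffAt hqAt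

end GenuineTower

end Summit.ABC.IUTFork.Joshi.ATS4

end
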